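import Literature.NumberTheory.PAdicHodge.BmaxPlusBdRModFil
import HarnessLib

/-!
# The comparison `B_max⁺ → B_dR⁺/Fil^k` commutes with Fontaine's `θ`

Topic `Literature/NumberTheory/PAdicHodge`; namespace `Literature.NumberTheory.PAdicHodge`. THEOREMS ONLY (no definition, no named
fact, no instance, no `sorry`). Sequel of `BmaxPlusBdRModFil` (`exists_bdR_lim_modFil`). For `x ∈ B_max⁺(F)` with `θ_max(x) ∈ 𝒪_{ℂ_F}`
(`thetaBmaxPlus`, the `p`-adically continuous extension of `θ` to `B_max⁺`) and a limit `L ∈ B_dR⁺` of `x` modulo `Fil^k`, `k ≥ 1`: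

* `thetaBdR_algebraMap_coe` — `θ_dR(ι₀ y) = θ⁰(y)` for `y ∈ B⁰_max` (`y = (ξ/p)z + a`);
* ★ `thetaBdR_eq_of_bdR_lim_modFil` — **`θ_dR(L) = θ_max(x)`**: the lattices `Λ(N, k)` are `θ`-small (`norm_thetaBdR_le_of_eq`) and
  `θ_max(x) ≡ θ⁰(x mod p^M) (mod p^M)`.

So the comparison `B_max⁺ → B_dR⁺/Fil^k` (`k ≥ 1`) is a homomorphism of `𝒪_{ℂ_F}`-augmented rings; in particular it maps `ker θ_max`
into `ker θ_dR = Fil¹`. Brick B5 of the φ-road of line `kato_lever` (crux K★ `stmt-BirchSwinnertonDyer-22226`); infrastructure only,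
BSD / K★ are not proved by this.

## References
* [Colmez1998Annals] P. Colmez, *Théorie d'Iwasawa des représentations de de Rham d'un corps local*, Ann. of Math. 148 (1998), §III.2.
* [FontaineAsterisque223III] J.-M. Fontaine, *Le corps des périodes p-adiques*, Astérisque 223 (1994), Exp. II §1.5.2–1.5.3.
-/

noncomputable section

open WittVector Field ValuativeRel Polynomial Finset
open Literature.AlgebraicGeometry.Resolution

namespace Literature.NumberTheory.PAdicHodge

open Literature.NumberTheory.GaloisRepresentations
open Literature.NumberTheory.GaloisRepresentations.IsNonarchimedeanLocalField

variable {F : Type} [Field F] [ValuativeRel F] [TopologicalSpace F] [IsNonarchimedeanLocalField F]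
  [CharZero F] {p : ℕ} [Fact p.Prime] [Fact (¬ IsUnit (p : integerC F))]
  [IsAdicComplete (Ideal.span {(p : integerC F)}) (integerC F)]

omit [CharZero F] in
/-- `ι₀` as the ring map `(𝔸_inf[1/p] → B_dR⁺) ∘ val`. [folklore: unfolding] -/
private theorem comp_val_apply₃ (y : bmaxZero F p) :
    ((algebraMap (Localization.Away (p : Ainf (p := p) F)) (BDeRhamPlus (integerC F) p)).comp (bmaxZero F p).val.toRingHom) y =
      algebraMap (Localization.Away (p : Ainf (p := p) F)) (BDeRhamPlus (integerC F) p) (y : Localization.Away (p : Ainf (p := p) F)) := rfl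

omit [CharZero F] in
/-- `ι₀ ∘ (𝔸_inf → B⁰_max) = ι : 𝔸_inf → B_dR⁺`. [folklore: unfolding of the structure maps] -/
private theorem algebraMap_coe_algebraMap₃ (a : Ainf (p := p) F) :
    algebraMap (Localization.Away (p : Ainf (p := p) F)) (BDeRhamPlus (integerC F) p)
        ((algebraMap (Ainf (p := p) F) (bmaxZero F p) a : bmaxZero F p) : Localization.Away (p : Ainf (p := p) F)) =
      ainfToBdR a := rfl

/-- **`θ_dR(ι₀(ξ/p)) = 0`** (`p · ι₀(ξ/p) = ξ_dR`, `θ_dR(ξ_dR) = 0`, `ℂ_F` has characteristic `0`). [cite: Colmez1998Annals, §III.2] -/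
theorem thetaBdR_algebraMap_coe_omegaB :
    thetaBdR (algebraMap (Localization.Away (p : Ainf (p := p) F)) (BDeRhamPlus (integerC F) p)
      ((omegaB : bmaxZero F p) : Localization.Away (p : Ainf (p := p) F))) = 0 := by
  have h := congrArg ((algebraMap (Localization.Away (p : Ainf (p := p) F)) (BDeRhamPlus (integerC F) p)).comp
    (bmaxZero F p).val.toRingHom) (natCast_mul_omegaB (F := F) (p := p))
  rw [map_mul, map_natCast, comp_val_apply₃, comp_val_apply₃, algebraMap_coe_algebraMap₃, ainfToBdR_xi] at h
  have h2 := congrArg thetaBdR h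
  rw [map_mul, map_natCast, thetaBdR_xiBdR] at h2
  exact (mul_eq_zero.1 h2).resolve_left (natCast_C_ne_zero (F := F) (Fact.out : p.Prime).ne_zero)

/-- **`θ_dR ∘ ι₀ = θ⁰` on `B⁰_max`**: `θ_dR(ι₀ y) = θ⁰(y)` (write `y = (ξ/p)·z + a` with `a ∈ 𝔸_inf`). [cite: Colmez1998Annals, §III.2] -/
theorem thetaBdR_algebraMap_coe (y : bmaxZero F p) :
    thetaBdR (algebraMap (Localization.Away (p : Ainf (p := p) F)) (BDeRhamPlus (integerC F) p) (y : Localization.Away (p : Ainf (p := p) F))) =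
      ((thetaBmaxZero F p y : integerC F) : CompletedAlgClosure F) := by
  obtain ⟨z, a, rfl⟩ := exists_eq_omegaB_mul_add_algebraMap y
  rw [thetaBmaxZero_omegaB_mul_add, ← comp_val_apply₃, map_add, map_mul, comp_val_apply₃, comp_val_apply₃, comp_val_apply₃,
    algebraMap_coe_algebraMap₃, map_add, map_mul, thetaBdR_algebraMap_coe_omegaB, zero_mul, zero_add, thetaBdR_ainfToBdR]

set_option maxHeartbeats 3200000 in
/-- ★ **The comparison commutes with `θ`**: if `L ∈ B_dR⁺` is a limit of `x ∈ B_max⁺` modulo `Fil^k` with `k ≥ 1` (in the sense of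
`exists_bdR_lim_modFil`), then `θ_dR(L) = θ_max(x)` in `ℂ_F` (`θ(Λ(N, k)) ⊆ p^N 𝒪_{ℂ_F}` and `θ_max(x) ≡ θ⁰(x mod p^M) (mod p^M)` for all
`N`, `M`). [cite: Colmez1998Annals, §III.2] [cite: FontaineAsterisque223III, Exp. II §1.5.3] -/
theorem thetaBdR_eq_of_bdR_lim_modFil {x : BmaxPlus F p} {k : ℕ} (hk : 1 ≤ k) {L : BDeRhamPlus (integerC F) p} {r : ℕ}
    (h : ∀ N M : ℕ, N + r ≤ M → ∀ y : bmaxZero F p,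
      AdicCompletion.evalₐ (Ideal.span {(p : bmaxZero F p)}) M x = Ideal.Quotient.mk _ y →
      ∃ (a : Ainf (p := p) F) (w : BDeRhamPlus (integerC F) p),
        (p : BDeRhamPlus (integerC F) p) ^ k *
            (L - algebraMap (Localization.Away (p : Ainf (p := p) F)) (BDeRhamPlus (integerC F) p)
              (y : Localization.Away (p : Ainf (p := p) F))) =
          ainfToBdR ((p : Ainf (p := p) F) ^ N * a) + xiBdR ^ k * w) :
    thetaBdR L = ((thetaBmaxPlus F p x : integerC F) : CompletedAlgClosure F) := by
  have hp := (Fact.out : p.Prime)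
  have hp0 : (p : CompletedAlgClosure F) ≠ 0 := natCast_C_ne_zero hp.ne_zero
  have hlt : ‖(p : CompletedAlgClosure F)‖ < 1 := norm_natCast_C_lt_one'
  -- `D := p^k (θ_dR L − θ_max x)` has norm `≤ ‖p‖^N` for every `N`
  set D : CompletedAlgClosure F := (p : CompletedAlgClosure F) ^ k *
    (thetaBdR L - ((thetaBmaxPlus F p x : integerC F) : CompletedAlgClosure F)) with hD
  have hsmall : ∀ N : ℕ, ‖D‖ ≤ ‖(p : CompletedAlgClosure F)‖ ^ N := by
    intro N
    obtain ⟨y, hy⟩ := Ideal.Quotient.mk_surjective (AdicCompletion.evalₐ (Ideal.span {(p : bmaxZero F p)}) (N + r) x)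
    obtain ⟨a, w, e⟩ := h N (N + r) le_rfl y hy.symm
    -- the lattice part
    have h1 : ‖thetaBdR ((p : BDeRhamPlus (integerC F) p) ^ k *
        (L - algebraMap (Localization.Away (p : Ainf (p := p) F)) (BDeRhamPlus (integerC F) p) (y : Localization.Away (p : Ainf (p := p) F))))‖ ≤
        ‖(p : CompletedAlgClosure F)‖ ^ N := GaloisContinuity.norm_thetaBdR_le_of_eq (by omega) e
    rw [map_mul, map_pow, map_natCast, map_sub, thetaBdR_algebraMap_coe] at h1
    -- the level part: `θ_max x − θ⁰ y ∈ p^{N+r} 𝒪`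
    have h2 := thetaBmaxPlus_sub_mem_of_evalₐ_eq hy.symm
    rw [Ideal.span_singleton_pow, Ideal.mem_span_singleton'] at h2
    obtain ⟨c, hc⟩ := h2
    have h3 : ((thetaBmaxZero F p y : integerC F) : CompletedAlgClosure F) =
        ((thetaBmaxPlus F p x : integerC F) : CompletedAlgClosure F) - (c : CompletedAlgClosure F) * (p : CompletedAlgClosure F) ^ (N + r) := by
      have h4 := congrArg (fun z : integerC F => (z : CompletedAlgClosure F)) hc
      simp only [Subring.coe_mul, SubmonoidClass.coe_pow, coe_natCast_integerC, AddSubgroupClass.coe_sub] at h4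
      linear_combination h4
    rw [h3] at h1
    have e5 : (p : CompletedAlgClosure F) ^ k * (thetaBdR L - (((thetaBmaxPlus F p x : integerC F) : CompletedAlgClosure F) -
        (c : CompletedAlgClosure F) * (p : CompletedAlgClosure F) ^ (N + r))) =
        D + (p : CompletedAlgClosure F) ^ k * (c : CompletedAlgClosure F) * (p : CompletedAlgClosure F) ^ (N + r) := by
      rw [hD]; ring
    rw [e5] at h1
    -- ultrametric: `‖D‖ ≤ max ‖D + E‖ ‖E‖` with both `≤ ‖p‖^N`
    have hE : ‖(p : CompletedAlgClosure F) ^ k * (c : CompletedAlgClosure F) * (p : CompletedAlgClosure F) ^ (N + r)‖ ≤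
        ‖(p : CompletedAlgClosure F)‖ ^ N := by
      rw [norm_mul, norm_mul, norm_pow, norm_pow, pow_add]
      calc ‖(p : CompletedAlgClosure F)‖ ^ k * ‖(c : CompletedAlgClosure F)‖ *
            (‖(p : CompletedAlgClosure F)‖ ^ N * ‖(p : CompletedAlgClosure F)‖ ^ r)
          ≤ 1 * 1 * (‖(p : CompletedAlgClosure F)‖ ^ N * 1) := by
            gcongr
            · exact pow_le_one₀ (norm_nonneg _) hlt.le
            · exact norm_coe_integerC_le c
            · exact pow_le_one₀ (norm_nonneg _) hlt.le
        _ = ‖(p : CompletedAlgClosure F)‖ ^ N := by ring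
    have e6 : D = (D + (p : CompletedAlgClosure F) ^ k * (c : CompletedAlgClosure F) * (p : CompletedAlgClosure F) ^ (N + r)) +
        -((p : CompletedAlgClosure F) ^ k * (c : CompletedAlgClosure F) * (p : CompletedAlgClosure F) ^ (N + r)) := by ring
    rw [e6]
    refine (IsUltrametricDist.norm_add_le_max _ _).trans ?_
    rw [norm_neg]
    exact max_le h1 hE
  -- hence `D = 0`
  have hD0 : D = 0 := by
    by_contra hne
    have hpos : 0 < ‖D‖ := norm_pos_iff.2 hne
    obtain ⟨N, hN⟩ := exists_pow_lt_of_lt_one hpos hlt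
    exact absurd (hsmall N) (not_le.2 hN)
  have h7 : thetaBdR L - ((thetaBmaxPlus F p x : integerC F) : CompletedAlgClosure F) = 0 :=
    (mul_eq_zero.1 (hD ▸ hD0 : (p : CompletedAlgClosure F) ^ k * _ = 0)).resolve_left (pow_ne_zero _ hp0)
  exact sub_eq_zero.1 h7

end Literature.NumberTheory.PAdicHodge

end
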